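import Summits.RiemannHypothesis.RiemannHypothesis.Theorems.HandoffDodgerRateSevenHorizon
import HarnessLib

/-!
# HANDOFF — RATE 7/100 FROM 10⁴ (3): the window and rate conditions at `y = (23/25)L^{3/2}`, `C = 7/100`, for every prime `q ≥ 10⁴` (rh-explicit, W-P(P1)/(P2) item 19394 `DodgerFamilyFromTenThousand`, seat dodger-p2 gen2)

RH-FREE. HONEST FRAMING: nothing here bears on the truth of RH; part (3) of the discharge of the hypotheses of
`HandoffDodgerExplicitWindowCounting.dodger_witness_explicit_window_counting` at the uniform schedule `y = (23/25)L^{3/2}` and the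
PRINTED rate `C = 7/100`, for EVERY `q ≥ 10⁴`: the mollifier radius `r = 1/(q³+1)` (`9.21 ≤ L`, `23/5 ≤ b`, `2b ≤ L ≤ 2b + 1/100`),
`600r ≤ δL = y/√pU`, `0 ≤ δU = y/√pL ≤ 10⁻³`, the RATE BOUND **`δU ≤ (7/100)(log q)^{3/2}q^{−3/2}`** (from `T′ ≥ 17.059q` and `pL ≥ T′³/28.42`:
`√pL ≥ 13.15·q√q` and `23/25 ≤ (7/100)·13.15`), the gap-blind window clause `L/2 + δU ≤ (log q′)/2` for every `q′ ≥ q + 1`,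
`√q ≤ 1.0001e^b`, and the domination `5480(6.4b + 1.04) ≤ 17.06e^{2b}` used by part (2). gen11's `HandoffDodgerSmallWindow` (rate 1/5) and
this seat's `HandoffDodgerSlabFiveWindow` are the templates. No `sorry`, standard axioms, no definitions.

References: this track (ATTEMPT-19 §8, ATTEMPT-21 §4, ATTEMPT-23 §7; HOME/rh-explicit-dodger-p2/DODGER-STAGE2-PLAN.md §2).
-/

set_option linter.dupNamespace false

noncomputable section

open Real

namespace Summit.RiemannHypothesis.RiemannHypothesis.Theorems.Handoff

/-- `e^{9.21} ≤ 10000`, hence `9.21 ≤ log q` for `q ≥ 10000`. [folklore] -/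
theorem log_ge_of_ge_ten_thousand {q : ℕ} (hq : 10000 ≤ q) : 9.21 ≤ Real.log q := by
  have hq0 : (0 : ℝ) < q := by exact_mod_cast (by omega : 0 < q)
  rw [Real.le_log_iff_exp_le hq0]
  have h9e : Real.exp 1 ^ 9 = Real.exp 9 := by exact_mod_cast Real.exp_one_pow 9
  have e1 : Real.exp 9.21 = Real.exp 1 ^ 9 * Real.exp 0.21 := by rw [h9e, ← Real.exp_add]; norm_num
  have hlt := Real.exp_one_lt_d9
  have h10 : Real.exp 1 ^ 9 ≤ 2.7182818286 ^ 9 := pow_le_pow_left₀ (Real.exp_pos 1).le hlt.le 9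
  have h3 : Real.exp 0.21 ≤ 1.2338 := by
    have := Real.exp_bound' (x := (0.21 : ℝ)) (by norm_num) (by norm_num) (n := 4) (by norm_num)
    simp only [Finset.sum_range_succ, Finset.sum_range_zero, Nat.factorial] at this
    norm_num at this
    linarith
  have hq' : (10000 : ℝ) ≤ q := by exact_mod_cast hq
  rw [e1]
  calc Real.exp 1 ^ 9 * Real.exp 0.21 ≤ 2.7182818286 ^ 9 * 1.2338 := mul_le_mul h10 h3 (Real.exp_pos _).le (by positivity)
    _ ≤ q := by linarith

/-- The mollifier radius at `q ≥ 10000`: `0 < r ≤ 10⁻¹²`, `rq³ ≤ 1`, `9.21 ≤ L`, `q = e^L`, `23/5 ≤ b`, `2b ≤ L ≤ 2b + 1/100`, `r ≤ 10⁻⁸`.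
[this track, ATTEMPT-21 §4; DODGER-STAGE2-PLAN] -/
theorem radius_facts_seven {q : ℕ} {L b r : ℝ} (hq : 10000 ≤ q) (hL : L = Real.log q) (hr : r = 1 / ((q : ℝ) ^ 3 + 1))
    (hbq1 : b + r ≤ L / 2) (hbq2 : L / 2 ≤ b + 2 * r) :
    0 < r ∧ r ≤ 1 / 10 ^ 12 ∧ r * (q : ℝ) ^ 3 ≤ 1 ∧ 9.21 ≤ L ∧ (q : ℝ) = Real.exp L ∧ 23 / 5 ≤ b ∧
      2 * b ≤ L ∧ L ≤ 2 * b + 1 / 100 ∧ r ≤ 1 / 10 ^ 8 := by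
  have hq0 : (0 : ℝ) < q := by exact_mod_cast (by omega : 0 < q)
  have hqL : (q : ℝ) = Real.exp L := by rw [hL, Real.exp_log hq0]
  have hr0 : 0 < r := by rw [hr]; positivity
  have hL9 : 9.21 ≤ L := by rw [hL]; exact log_ge_of_ge_ten_thousand hq
  have hq' : (10000 : ℝ) ≤ q := by exact_mod_cast hq
  have hq3 : (10000 : ℝ) ^ 3 ≤ (q : ℝ) ^ 3 := pow_le_pow_left₀ (by norm_num) hq' 3
  have hr1 : r ≤ 1 / 10 ^ 12 := by
    rw [hr]; apply div_le_div_of_nonneg_left (by norm_num) (by norm_num); nlinarith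
  have hrq : r * (q : ℝ) ^ 3 ≤ 1 := by
    rw [hr, div_mul_eq_mul_div, one_mul, div_le_one (by positivity)]; linarith
  have hr8 : r ≤ 1 / 10 ^ 8 := hr1.trans (by norm_num)
  exact ⟨hr0, hr1, hrq, hL9, hqL, by linarith, by linarith, by linarith, hr8⟩

/-- `600r ≤ δL = y/√pU` at `y² = (529/625)L³`, `L ≥ 9`, `2b ≤ L`, `pU ≤ 0.3184bT³`, `T ≤ 17.1q`, `r ≤ 10⁻¹²`, `rq³ ≤ 1`.
[this track, ATTEMPT-21 §4] -/
theorem radius_le_deltaL_seven {q : ℕ} {L b r T pU y : ℝ} (hr0 : 0 < r) (hr12 : r ≤ 1 / 10 ^ 12) (hrq : r * (q : ℝ) ^ 3 ≤ 1)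
    (hq0 : (0 : ℝ) < q) (hL9 : 9 ≤ L) (hL1 : 2 * b ≤ L) (hT0 : 0 < T) (hTq1 : T ≤ 17.1 * q) (hpU0 : 0 < pU)
    (hpU : pU ≤ 0.3184 * b * T ^ 3) (hy0 : 0 ≤ y) (hy2 : y ^ 2 = 529 / 625 * L ^ 3) :
    600 * r ≤ y / Real.sqrt pU := by
  have e : y / Real.sqrt pU = Real.sqrt (y ^ 2 / pU) := by rw [Real.sqrt_div (sq_nonneg y), Real.sqrt_sq hy0]
  rw [e, Real.le_sqrt (by linarith) (by positivity), le_div_iff₀ hpU0, hy2]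
  have h1 : T ^ 3 ≤ (17.1 * q) ^ 3 := pow_le_pow_left₀ hT0.le hTq1 3
  have h2 : (600 * r) ^ 2 * pU ≤ (600 * r) ^ 2 * (0.3184 * (L / 2) * (17.1 * q) ^ 3) := by
    apply mul_le_mul_of_nonneg_left _ (by positivity)
    calc pU ≤ 0.3184 * b * T ^ 3 := hpU
      _ ≤ 0.3184 * (L / 2) * (17.1 * q) ^ 3 := by
        apply mul_le_mul (by linarith) h1 (by positivity) (by positivity)
  have h3 : (600 * r) ^ 2 * (0.3184 * (L / 2) * (17.1 * q) ^ 3) ≤ L := by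
    have : (600 * r) ^ 2 * (0.3184 * (L / 2) * (17.1 * q) ^ 3) =
        360000 * (0.3184 / 2) * 17.1 ^ 3 * (r * (r * (q : ℝ) ^ 3)) * L := by ring
    rw [this]
    have h4 : r * (r * (q : ℝ) ^ 3) ≤ 1 / 10 ^ 12 * 1 := mul_le_mul hr12 hrq (by positivity) (by norm_num)
    nlinarith
  have hL3 : 81 * L ≤ L ^ 3 := by
    have hL2 : 9 * L ≤ L ^ 2 := by nlinarith
    nlinarith [hL2]
  nlinarith

/-- `T′ ≥ 17.059q` from `17.06e^{2b} ≤ T′` and `e^{2b} ≥ q·e^{−4r} ≥ q(1 − 4r)`, `r ≤ 10⁻⁸`. [this track, DODGER-STAGE2-PLAN] -/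
theorem Tprime_ge_q_seven {q : ℕ} {L b r T : ℝ} (hqL : (q : ℝ) = Real.exp L) (hq0 : (0 : ℝ) < q)
    (hr8 : r ≤ 1 / 10 ^ 8) (hbq2 : L / 2 ≤ b + 2 * r) (hTe : 17.06 * Real.exp (2 * b) ≤ T) : 17.059 * q ≤ T := by
  have h1 : Real.exp (L - 4 * r) ≤ Real.exp (2 * b) := Real.exp_le_exp.2 (by linarith)
  have h2 : Real.exp (L - 4 * r) = q * Real.exp (-(4 * r)) := by rw [sub_eq_add_neg, Real.exp_add, hqL]
  have h3 : 1 - 4 * r ≤ Real.exp (-(4 * r)) := by have := Real.add_one_le_exp (-(4 * r)); linarith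
  have h4 : (q : ℝ) * (1 - 4 * r) ≤ q * Real.exp (-(4 * r)) := mul_le_mul_of_nonneg_left h3 hq0.le
  nlinarith

/-- The rate bound `δU = (23/25)L√L/√pL ≤ (7/100)·L√L/(q√q)` (`17.059q ≤ T`, `pL ≥ T³/28.42`: `√pL ≥ 13.15·q√q`, `23/25 ≤ (7/100)·13.15`).
[this track, DODGER-STAGE2-PLAN] -/
theorem deltaU_rate_seven {q : ℕ} {L T pL : ℝ} (hq0 : (0 : ℝ) < q) (hL0 : 0 < L) (hTq2 : 17.059 * q ≤ T)
    (hpL : T ^ 3 / 28.42 ≤ pL) :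
    23 / 25 * (L * Real.sqrt L) / Real.sqrt pL ≤ 7 / 100 * (L * Real.sqrt L) / ((q : ℝ) * Real.sqrt q) := by
  have hpLq : (13.15 : ℝ) ^ 2 * (q : ℝ) ^ 3 ≤ pL := by
    have h1 : (17.059 * q) ^ 3 ≤ T ^ 3 := pow_le_pow_left₀ (by positivity) hTq2 3
    have h4 : T ^ 3 ≤ 28.42 * pL := by rw [div_le_iff₀ (by norm_num)] at hpL; linarith
    nlinarith [pow_pos hq0 3]
  have hpL0 : 0 < pL := lt_of_lt_of_le (by positivity) hpLq
  rw [div_le_div_iff₀ (Real.sqrt_pos.2 hpL0) (by positivity)]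
  have hs : 13.15 * ((q : ℝ) * Real.sqrt q) ≤ Real.sqrt pL := by
    rw [Real.le_sqrt (by positivity) hpL0.le, mul_pow, mul_pow, Real.sq_sqrt hq0.le]
    nlinarith
  have hLL : 0 ≤ L * Real.sqrt L := by positivity
  have hqq : 0 ≤ (q : ℝ) * Real.sqrt q := by positivity
  calc 23 / 25 * (L * Real.sqrt L) * ((q : ℝ) * Real.sqrt q)
      ≤ 7 / 100 * 13.15 * (L * Real.sqrt L) * ((q : ℝ) * Real.sqrt q) := by nlinarith [mul_nonneg hLL hqq]
    _ = 7 / 100 * (L * Real.sqrt L) * (13.15 * ((q : ℝ) * Real.sqrt q)) := by ring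
    _ ≤ 7 / 100 * (L * Real.sqrt L) * Real.sqrt pL := mul_le_mul_of_nonneg_left hs (by positivity)

/-- The window bound `(7/100)·L√L/(q√q) ≤ 1/(2(q+1))` for `q = e^L ≥ 10000`, `L ≥ 9`. [this track, ATTEMPT-21 §4] -/
theorem rate_le_half_inv_seven {q : ℕ} {L : ℝ} (hqL : (q : ℝ) = Real.exp L) (hq : 10000 ≤ q) (hL9 : 9 ≤ L) :
    7 / 100 * (L * Real.sqrt L) / ((q : ℝ) * Real.sqrt q) ≤ 1 / (2 * ((q : ℝ) + 1)) := by
  have hL0 : 0 < L := by linarith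
  have hq0 : (0 : ℝ) < q := by exact_mod_cast (by omega : 0 < q)
  have hq' : (10000 : ℝ) ≤ q := by exact_mod_cast hq
  rw [div_le_div_iff₀ (by positivity) (by positivity)]
  have hsq : 0.405 * (L * Real.sqrt L) ≤ Real.sqrt q := by
    rw [Real.le_sqrt (by positivity) hq0.le, mul_pow, mul_pow, Real.sq_sqrt hL0.le]
    have h3 : L ^ 3 / 6 ≤ Real.exp L := by
      have := Real.pow_div_factorial_le_exp L hL0.le 3
      norm_num [Nat.factorial] at this; exact this
    rw [← hqL] at h3
    nlinarith [pow_pos hL0 3]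
  have hLL : 0 ≤ L * Real.sqrt L := by positivity
  nlinarith [mul_le_mul_of_nonneg_left hsq hq0.le, Real.sqrt_nonneg (q : ℝ), mul_nonneg hLL (Real.sqrt_nonneg (q : ℝ)),
    mul_le_mul_of_nonneg_left hq' hLL]

/-- The domination `5480(6.4b + 1.04) ≤ 17.06e^{2b}` for `b ≥ 23/5` (feeds `5480N₁ ≤ T′` in part (2)). [this track, DODGER-STAGE2-PLAN] -/
theorem exp_dominates_N_seven {b : ℝ} (hb : 23 / 5 ≤ b) : 5480 * (6.4 * b + 1.04) ≤ 17.06 * Real.exp (2 * b) := by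
  obtain ⟨-, hmain, -, -, -, -⟩ := exp_two_mul_bounds_seven hb
  set t : ℝ := 2 * b - 46 / 5 with ht
  have ht0 : 0 ≤ t := by rw [ht]; linarith
  have hb' : b = 23 / 5 + t / 2 := by rw [ht]; ring
  have h1 : 5480 * (6.4 * b + 1.04) ≤ 17.06 * (9885 * (1 + t + t ^ 2 / 2)) := by
    rw [hb']; nlinarith only [ht0]
  linarith only [h1, hmain]

/-- **Part (3) of the rate-7/100 discharge: the window conditions at `y = (23/25)L^{3/2}`, `C = 7/100`, for every `q ≥ 10⁴`.**
[this track, ATTEMPT-21 §4, ATTEMPT-23 §7; DODGER-STAGE2-PLAN] -/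
theorem window_conditions_seven {q : ℕ} {L b r T pL pU y δU δL : ℝ} (hq : 10000 ≤ q) (hL : L = Real.log q)
    (hr : r = 1 / ((q : ℝ) ^ 3 + 1)) (hbq1 : b + r ≤ L / 2) (hbq2 : L / 2 ≤ b + 2 * r)
    (hTe : 17.06 * Real.exp (2 * b) ≤ T) (hTT₀ : T ≤ 2 * π * Real.exp (1 + 2 * b))
    (hpL : T ^ 3 / 28.42 ≤ pL) (hpU0 : 0 < pU) (hpU : pU ≤ 0.3184 * b * T ^ 3)
    (hy : y = 23 / 25 * (L * Real.sqrt L)) (hδU : δU = y / Real.sqrt pL) (hδL : δL = y / Real.sqrt pU) :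
    (23 / 5 ≤ b ∧ 2 * b ≤ L ∧ L ≤ 2 * b + 1 / 100 ∧ 9.21 ≤ L) ∧ (0 ≤ δU ∧ δU ≤ 1 / 1000 ∧ δU ≤ b) ∧
      (600 * r ≤ δL ∧ 6 * r ≤ δL) ∧
      δU ≤ 7 / 100 * Real.log q ^ (3 / 2 : ℝ) * (q : ℝ) ^ (-(3 / 2 : ℝ)) ∧
      (∀ q' : ℕ, q + 1 ≤ q' → Real.log q / 2 + δU ≤ Real.log q' / 2) ∧
      (0 < Real.sqrt q ∧ Real.sqrt q ≤ 1.0001 * Real.exp b) ∧ 17.059 * q ≤ T := by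
  have hπ4 : π < 3.1416 := Real.pi_lt_d4
  have hq0 : (0 : ℝ) < q := by exact_mod_cast (by omega : 0 < q)
  obtain ⟨hr0, hr1, hrq, hL9, hqL, hb, hL1, hL2, hr8⟩ := radius_facts_seven hq hL hr hbq1 hbq2
  obtain ⟨he, -, -, -, -, -⟩ := exp_two_mul_bounds_seven hb
  have hL0 : 0 < L := by linarith
  have hT0 : 0 < T := by nlinarith [Real.exp_pos (2 * b)]
  have hpL0 : 0 < pL := lt_of_lt_of_le (by positivity) hpL
  have hy0 : 0 ≤ y := by rw [hy]; positivity
  have hy2 : y ^ 2 = 529 / 625 * L ^ 3 := by rw [hy, mul_pow, mul_pow, Real.sq_sqrt hL0.le]; ring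
  have hδU0 : 0 ≤ δU := by rw [hδU]; positivity
  -- `T ≤ 2πe·e^{2b} ≤ 17.08·q`
  have hE1 : Real.exp (2 * b) ≤ q := by rw [hqL]; exact Real.exp_le_exp.2 (by linarith)
  have hTq1 : T ≤ 17.1 * q := by
    have e1 : Real.exp (1 + 2 * b) = Real.exp 1 * Real.exp (2 * b) := by rw [Real.exp_add]
    rw [e1] at hTT₀
    have h2πe : 2 * π * Real.exp 1 ≤ 17.1 := by
      have hel := Real.exp_one_lt_d9
      nlinarith only [hπ4, hel, Real.exp_pos 1, Real.pi_pos]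
    have := mul_le_mul h2πe hE1 (Real.exp_pos _).le (by norm_num)
    nlinarith only [this, hTT₀, Real.exp_pos (2 * b), Real.pi_pos, Real.exp_pos 1]
  have hTq2 : 17.059 * q ≤ T := Tprime_ge_q_seven hqL hq0 hr8 hbq2 hTe
  have hδL600 : 600 * r ≤ δL := by
    rw [hδL]; exact radius_le_deltaL_seven hr0 hr1 hrq hq0 (by linarith) hL1 hT0 hTq1 hpU0 hpU hy0 hy2
  have hδL6 : 6 * r ≤ δL := by linarith
  have hrate : δU ≤ 7 / 100 * (L * Real.sqrt L) / ((q : ℝ) * Real.sqrt q) := by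
    rw [hδU, hy]; exact deltaU_rate_seven hq0 hL0 hTq2 hpL
  have h3 : δU ≤ 1 / (2 * ((q : ℝ) + 1)) := hrate.trans (rate_le_half_inv_seven hqL hq (by linarith))
  have hδU1 : δU ≤ 1 / 1000 := by
    have hq'' : (10000 : ℝ) ≤ q := by exact_mod_cast hq
    have h4 : 1 / (2 * ((q : ℝ) + 1)) ≤ 1 / 1000 := div_le_div_of_nonneg_left (by norm_num) (by norm_num) (by linarith)
    linarith
  have rpow32 : ∀ x : ℝ, 0 ≤ x → x ^ (3 / 2 : ℝ) = x * Real.sqrt x := fun x hx => by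
    rw [show (3 / 2 : ℝ) = 1 + 1 / 2 by norm_num, Real.rpow_add' hx (by norm_num), Real.rpow_one, Real.sqrt_eq_rpow]
  have hrate' : δU ≤ 7 / 100 * Real.log q ^ (3 / 2 : ℝ) * (q : ℝ) ^ (-(3 / 2 : ℝ)) := by
    rw [← hL, Real.rpow_neg hq0.le, rpow32 _ hL0.le, rpow32 _ hq0.le, ← div_eq_mul_inv]
    exact hrate
  have hwin : ∀ q' : ℕ, q + 1 ≤ q' → Real.log q / 2 + δU ≤ Real.log q' / 2 := by
    intro q' hq'
    have hq'0 : (q : ℝ) + 1 ≤ q' := by exact_mod_cast hq'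
    have h1 : Real.log ((q : ℝ) + 1) ≤ Real.log q' := Real.log_le_log (by positivity) hq'0
    have h2 : 1 / ((q : ℝ) + 1) ≤ Real.log ((q : ℝ) + 1) - Real.log q := by
      have := Real.one_sub_inv_le_log_of_pos (show 0 < ((q : ℝ) + 1) / q by positivity)
      rw [Real.log_div (by positivity) hq0.ne', inv_div] at this
      have e : 1 - (q : ℝ) / (q + 1) = 1 / (q + 1) := by field_simp; ring
      linarith
    have h4 : 1 / (2 * ((q : ℝ) + 1)) * 2 = 1 / ((q : ℝ) + 1) := by field_simp
    rw [← hL] at h2 ⊢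
    linarith
  have hsq : Real.sqrt q = Real.exp (L / 2) := by
    rw [hqL, show Real.exp L = Real.exp (L / 2) ^ 2 by rw [← Real.exp_nat_mul]; ring_nf,
      Real.sqrt_sq (Real.exp_pos _).le]
  have hsq1 : Real.sqrt q ≤ 1.0001 * Real.exp b := by
    rw [hsq]
    have h1 : Real.exp (L / 2) ≤ Real.exp (b + 2 * r) := Real.exp_le_exp.2 hbq2
    rw [Real.exp_add] at h1
    have h2 : Real.exp (2 * r) ≤ 1 + 2 * (2 * r) := by
      have h2r : 0 ≤ 2 * r := by linarith
      have := Real.abs_exp_sub_one_le (x := 2 * r) (by rw [abs_of_nonneg h2r]; linarith)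
      rw [abs_of_nonneg h2r] at this
      have := (abs_le.1 this).2
      linarith
    have h3 : Real.exp b * Real.exp (2 * r) ≤ Real.exp b * 1.0001 :=
      mul_le_mul_of_nonneg_left (by linarith) (Real.exp_pos b).le
    linarith
  exact ⟨⟨hb, hL1, hL2, hL9⟩, ⟨hδU0, hδU1, by linarith⟩, ⟨hδL600, hδL6⟩, hrate', hwin, ⟨Real.sqrt_pos.2 hq0, hsq1⟩, hTq2⟩

end Summit.RiemannHypothesis.RiemannHypothesis.Theorems.Handoff

end
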